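import Summits.CriticalPhenomena.PercolationContinuityZ3.Theorems.PercNearOneGluingAdditiveGluingFibreSwapB
import HarnessLib

/-!
# Crux `PercNearOneGluing.AdditiveGluing` (stmt-CriticalPhenomena-4576), line `tieline`:
# the o-side involution ψ_o — fibre counts of (T) reduce to the triples where `o`'s `(ω¹ ∪ ω³)`-component is not cut off by `{u, c}`

Support file (`--supports stmt-CriticalPhenomena-4576`, helper, seat (d) exchange-certificate form).  No named facts,
no sorries, no definitions.

The signed summand of `fibreSumT o b u v c I` at a replica triple `(ω¹, ω², ω³)` is `N₁ D₂ D₃ (ub₂ − ub₃)(vo₃ − oc₁·vc₃)`.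
EXCHCERT-g6 §5 (exact on 30 048 / 30 048 terms): let `R` be the set of vertices joined to `o` by a path of `(ω¹ ∪ ω³)`-open
edges avoiding `u` and `c`.  If `v ∉ R`, and either `b ∉ R` or no `(ω¹ ∪ ω³)`-open edge joins `R` to `u`, then swapping the
replica labels `1 ↔ 3` on the edges touching `R` negates the summand (the separator argument of `…FibreLocus`, with the
adaptive region `R` in place of the graph-theoretic component: `vo₃ = vc₃ ∧ E₃`, `oc₁ = E₁`, `E₁ ↔ E₃` exchanged, every
other factor decided off `R`).  Since `ω¹ ∪ ω³`, hence `R`, is invariant under the swap, this is a count-preserving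
involution of the invariant family, and (`fibreSumT_eq_sum_cutoff`):

  `fibreSumT o b u v c I = Σ { summand(t) : cnt t = I, ¬(v ∉ R(t) ∧ (b ∉ R(t) ∨ R(t) has no (ω¹ ∪ ω³)-edge to u)) }`.

Together with `fibreSumT_eq_sum_hanging` (ψ_b, file `…FibreSwapB`) these are the two exact partial involutions of the
crux memos; the locus theorem of `…FibreLocus` is the case where `R(t)` is the same for all triples.
[folklore] (sign-reversing involution on an invariant sub-family; 2-vertex separator surgery on open paths)
-/

namespace Summit.CriticalPhenomena.PercolationContinuityZ3.Cruxes.AdditiveGluing.TieLine.FibreCount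

open MeasureTheory Set Finset Literature.Probability.Percolation
open Literature.Probability.LatticeModels (prodBernoulli)

open Classical

section SwapO

variable {n : ℕ}

/-- In the open graph of a configuration with all edges at `u` and at `c` removed, `u` is isolated. [folklore] -/
theorem eq_of_reachable_avoid₂ {ω : Set (Sym2 (Fin n))} {u c o : Fin n}
    (h : (openGraph (ω \ {e | u ∈ e ∨ c ∈ e})).Reachable o u) : o = u := by
  rw [SimpleGraph.reachable_iff_reflTransGen] at h
  rcases Relation.ReflTransGen.cases_tail h with hou | ⟨z, _, hzu⟩
  · exact hou.symm
  · exfalso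
    rw [openGraph_adj] at hzu
    exact hzu.1.2 (Or.inl (Sym2.mem_mk_right z u))

/-- Closedness modulo `{u, c}` of the set `R` of vertices joined to `o ∉ {u, c}` by open edges of `ω` avoiding `u, c`, for
every sub-configuration `η ⊆ ω`; if no edge of `ω` joins `R` to `u`, closedness modulo `{c}`.  The set `Z` is described by
`hZ : z ∈ Z ↔ z = c ∨ (z = u ∧ some edge of ω joins R to u)`. [folklore] -/
theorem closed_of_subset_reach₂ {η ω : Set (Sym2 (Fin n))} {u c o : Fin n} {Z : Set (Fin n)} (hou : o ≠ u) (hoc : o ≠ c)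
    (hηω : η ⊆ ω)
    (hZ : ∀ z, z ∈ Z ↔ z = c ∨ (z = u ∧ ∃ e ∈ ω, u ∈ e ∧ ∃ y ∈ e, (openGraph (ω \ {e | u ∈ e ∨ c ∈ e})).Reachable o y)) :
    ∀ e ∈ η, ∀ x ∈ e, x ∈ {y | (openGraph (ω \ {e | u ∈ e ∨ c ∈ e})).Reachable o y} →
      ∀ y ∈ e, y ∈ {y | (openGraph (ω \ {e | u ∈ e ∨ c ∈ e})).Reachable o y} ∨ y ∈ Z := by
  intro e he x hx hxO y hy
  simp only [Set.mem_setOf_eq] at hxO ⊢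
  by_cases hyc : y = c
  · exact Or.inr ((hZ y).2 (Or.inl hyc))
  by_cases hyu : y = u
  · refine Or.inr ((hZ y).2 (Or.inr ⟨hyu, e, hηω he, hyu ▸ hy, x, hx, hxO⟩))
  left
  by_cases hxy : x = y
  · rw [← hxy]; exact hxO
  · have hxu : x ≠ u := fun hxu => hou (eq_of_reachable_avoid₂ (hxu ▸ hxO))
    have hxc : x ≠ c := by
      intro hxc
      -- `c` is isolated as well
      have h' : (openGraph (ω \ {e | u ∈ e ∨ c ∈ e})).Reachable o c := hxc ▸ hxO
      rw [SimpleGraph.reachable_iff_reflTransGen] at h'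
      rcases Relation.ReflTransGen.cases_tail h' with h'' | ⟨z, _, hzc⟩
      · exact hoc h''.symm
      · rw [openGraph_adj] at hzc
        exact hzc.1.2 (Or.inr (Sym2.mem_mk_right z c))
    have he' : e = s(x, y) := (Sym2.mem_and_mem_iff hxy).1 ⟨hx, hy⟩
    refine hxO.trans (SimpleGraph.Adj.reachable ?_)
    rw [openGraph_adj]
    refine ⟨⟨hηω (he' ▸ he), ?_⟩, hxy⟩
    simp only [Set.mem_setOf_eq, Sym2.mem_iff, not_or]
    exact ⟨⟨fun h => hxu h.symm, fun h => hyu h.symm⟩, fun h => hxc h.symm, fun h => hyc h.symm⟩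

/-- **The o-side sign reversal with an arbitrary closed region** (the proof of `summandT_swap_neg` of `…FibreLocus`, with
the closedness of `ω¹ ∪ ω³` modulo `Z ⊆ {u, c}` assumed directly instead of through a fixed edge set). [folklore] -/
theorem summandT_swap13_neg (o b u v c : Fin n) (F : Set (Sym2 (Fin n))) (O Z : Set (Fin n))
    (hF : ∀ e, e ∈ F ↔ ∃ x ∈ e, x ∈ O) (ho : o ∈ O) (hu : u ∉ O) (hv : v ∉ O) (hc : c ∉ O)
    (hZ : ∀ z ∈ Z, z = u ∨ z = c) (hb : b ∉ O ∨ u ∉ Z)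
    (t : Triple (Sym2 (Fin n)))
    (hO : ∀ e ∈ cfg t.1 ∪ cfg t.2.2, ∀ x ∈ e, x ∈ O → ∀ y ∈ e, y ∈ O ∨ y ∈ Z)
    (Φ : Triple (Sym2 (Fin n)) → Triple (Sym2 (Fin n)))
    (hΦ₁ : (Φ t).1 = fun i => if i ∈ F then t.2.2 i else t.1 i) (hΦ₂ : (Φ t).2.1 = t.2.1)
    (hΦ₃ : (Φ t).2.2 = fun i => if i ∈ F then t.1 i else t.2.2 i)
    (hne : 1 * ind ((openConn c u)ᶜ ∩ (openConn c v)ᶜ) ((openConn u v)ᶜ ∩ openConn u b) ((openConn u v)ᶜ ∩ openConn v o) t +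
        (-1) * ind ((openConn c u)ᶜ ∩ (openConn c v)ᶜ) (openConn u v)ᶜ ((openConn u v)ᶜ ∩ openConn u b ∩ openConn v o) t +
        (-1) * ind ((openConn c u)ᶜ ∩ (openConn c v)ᶜ ∩ openConn o c) ((openConn u v)ᶜ ∩ openConn u b)
          ((openConn u v)ᶜ ∩ openConn v c) t +
        1 * ind ((openConn c u)ᶜ ∩ (openConn c v)ᶜ ∩ openConn o c) (openConn u v)ᶜ
          ((openConn u v)ᶜ ∩ openConn u b ∩ openConn v c) t ≠ 0) :
    1 * ind ((openConn c u)ᶜ ∩ (openConn c v)ᶜ) ((openConn u v)ᶜ ∩ openConn u b) ((openConn u v)ᶜ ∩ openConn v o) (Φ t) +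
        (-1) * ind ((openConn c u)ᶜ ∩ (openConn c v)ᶜ) (openConn u v)ᶜ ((openConn u v)ᶜ ∩ openConn u b ∩ openConn v o) (Φ t) +
        (-1) * ind ((openConn c u)ᶜ ∩ (openConn c v)ᶜ ∩ openConn o c) ((openConn u v)ᶜ ∩ openConn u b)
          ((openConn u v)ᶜ ∩ openConn v c) (Φ t) +
        1 * ind ((openConn c u)ᶜ ∩ (openConn c v)ᶜ ∩ openConn o c) (openConn u v)ᶜ
          ((openConn u v)ᶜ ∩ openConn u b ∩ openConn v c) (Φ t) =
      -(1 * ind ((openConn c u)ᶜ ∩ (openConn c v)ᶜ) ((openConn u v)ᶜ ∩ openConn u b) ((openConn u v)ᶜ ∩ openConn v o) t +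
        (-1) * ind ((openConn c u)ᶜ ∩ (openConn c v)ᶜ) (openConn u v)ᶜ ((openConn u v)ᶜ ∩ openConn u b ∩ openConn v o) t +
        (-1) * ind ((openConn c u)ᶜ ∩ (openConn c v)ᶜ ∩ openConn o c) ((openConn u v)ᶜ ∩ openConn u b)
          ((openConn u v)ᶜ ∩ openConn v c) t +
        1 * ind ((openConn c u)ᶜ ∩ (openConn c v)ᶜ ∩ openConn o c) (openConn u v)ᶜ
          ((openConn u v)ᶜ ∩ openConn u b ∩ openConn v c) t) := by
  have hω₁' : cfg (Φ t).1 = (cfg t.1 \ F) ∪ (cfg t.2.2 ∩ F) := by rw [hΦ₁, cfg_ite]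
  have hω₂' : cfg (Φ t).2.1 = cfg t.2.1 := by rw [hΦ₂]
  have hω₃' : cfg (Φ t).2.2 = (cfg t.2.2 \ F) ∪ (cfg t.1 ∩ F) := by rw [hΦ₃, cfg_ite]
  -- unfold the summand's memberships into reachability statements, then name the configurations
  simp only [ind, hω₁', hω₂', hω₃', Set.mem_inter_iff, Set.mem_compl_iff, openConn, Set.mem_setOf_eq] at hne ⊢
  set ω₁ := cfg t.1 with hω₁
  set ω₂ := cfg t.2.1 with hω₂
  set ω₃ := cfg t.2.2 with hω₃
  set ω₁' := (ω₁ \ F) ∪ (ω₃ ∩ F) with hω₁'def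
  set ω₃' := (ω₃ \ F) ∪ (ω₁ ∩ F) with hω₃'def
  -- closedness of all four configurations
  have hO₁ : ∀ e ∈ ω₁, ∀ x ∈ e, x ∈ O → ∀ y ∈ e, y ∈ O ∨ y ∈ Z := closedMod_mono hO Set.subset_union_left
  have hO₃ : ∀ e ∈ ω₃, ∀ x ∈ e, x ∈ O → ∀ y ∈ e, y ∈ O ∨ y ∈ Z := closedMod_mono hO Set.subset_union_right
  have hO₁' : ∀ e ∈ ω₁', ∀ x ∈ e, x ∈ O → ∀ y ∈ e, y ∈ O ∨ y ∈ Z :=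
    closedMod_mono hO (Set.union_subset (Set.sdiff_subset.trans Set.subset_union_left)
      (Set.inter_subset_left.trans Set.subset_union_right))
  have hO₃' : ∀ e ∈ ω₃', ∀ x ∈ e, x ∈ O → ∀ y ∈ e, y ∈ O ∨ y ∈ Z :=
    closedMod_mono hO (Set.union_subset (Set.sdiff_subset.trans Set.subset_union_right)
      (Set.inter_subset_left.trans Set.subset_union_left))
  -- Step 1: the three standing constraints hold (else the summand vanishes)
  have hNu : ¬ (openGraph ω₁).Reachable c u := by
    by_contra hN; apply hne; simp [hN]
  have hNv : ¬ (openGraph ω₁).Reachable c v := by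
    by_contra hN; apply hne; simp [hN]
  have hD₂ : ¬ (openGraph ω₂).Reachable u v := by
    by_contra hD; apply hne; simp [hD]
  have hD₃ : ¬ (openGraph ω₃).Reachable u v := by
    by_contra hD; apply hne; simp [hD]
  -- Step 2: `v ↔ c` in replica 3 (else the summand vanishes), hence `u ↮ c` in replica 3
  have hvo₃ := reachable_vo_iff hF hO₃ hZ ho hv hD₃
  have hvc₃ : (openGraph ω₃).Reachable v c := by
    by_contra hvc
    have hvo : ¬ (openGraph ω₃).Reachable v o := fun h' => hvc (hvo₃.1 h').1
    apply hne; simp [hvc, hvo]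
  have huc₃ : ¬ (openGraph ω₃).Reachable u c := fun h' => hD₃ (h'.trans hvc₃.symm)
  -- Step 3: the excision hypotheses and the splice equivalences for vertices outside `O`
  have hZ₁ := pairwise_Z_of_not_reachable (ω := ω₁) (F := F) hZ
    (fun h' => hNu (h'.mono (BHK2006.openGraph_le Set.inter_subset_left)).symm)
  have hZ₃ := pairwise_Z_of_not_reachable (ω := ω₃) (F := F) hZ
    (fun h' => huc₃ (h'.mono (BHK2006.openGraph_le Set.inter_subset_left)))
  have hZ₁' : ∀ z₁ ∈ Z, ∀ z₂ ∈ Z, (openGraph (ω₁' ∩ F)).Reachable z₁ z₂ → z₁ = z₂ := by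
    rw [hω₁'def, splice_inter]; exact hZ₃
  have hZ₃' : ∀ z₁ ∈ Z, ∀ z₂ ∈ Z, (openGraph (ω₃' ∩ F)).Reachable z₁ z₂ → z₁ = z₂ := by
    rw [hω₃'def, splice_inter]; exact hZ₁
  have hag₁ : ω₁ \ F = ω₁' \ F := by rw [hω₁'def, splice_diff]
  have hag₃ : ω₃ \ F = ω₃' \ F := by rw [hω₃'def, splice_diff]
  have out₁ : ∀ {x y : Fin n}, x ∉ O → y ∉ O → ((openGraph ω₁).Reachable x y ↔ (openGraph ω₁').Reachable x y) :=
    fun hx hy => reachable_iff_of_agree_off hF hO₁ hO₁' hZ₁ hZ₁' hag₁ hx hy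
  have out₃ : ∀ {x y : Fin n}, x ∉ O → y ∉ O → ((openGraph ω₃).Reachable x y ↔ (openGraph ω₃').Reachable x y) :=
    fun hx hy => reachable_iff_of_agree_off hF hO₃ hO₃' hZ₃ hZ₃' hag₃ hx hy
  -- transported constraints
  have hNu' : ¬ (openGraph ω₁').Reachable c u := fun h' => hNu ((out₁ hc hu).2 h')
  have hNv' : ¬ (openGraph ω₁').Reachable c v := fun h' => hNv ((out₁ hc hv).2 h')
  have hD₃' : ¬ (openGraph ω₃').Reachable u v := fun h' => hD₃ ((out₃ hu hv).2 h')
  have hvc₃' : (openGraph ω₃').Reachable v c := (out₃ hv hc).1 hvc₃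
  -- Step 4: the component-side events `E₁`, `E₃` and the four reachability rewrites
  have hE₁' : (openGraph (ω₁' ∩ F)).Reachable o c ↔ (openGraph (ω₃ ∩ F)).Reachable o c := by
    rw [hω₁'def, splice_inter]
  have hE₃' : (openGraph (ω₃' ∩ F)).Reachable o c ↔ (openGraph (ω₁ ∩ F)).Reachable o c := by
    rw [hω₃'def, splice_inter]
  have hvo₃' := reachable_vo_iff hF hO₃' hZ ho hv hD₃'
  have hoc₁ := reachable_oc_iff hF hO₁ hZ ho hc hNu
  have hoc₁' := reachable_oc_iff hF hO₁' hZ ho hc hNu'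
  -- Step 5: `u ↔ b` is swap-invariant in replica 3 (replica 2 is untouched)
  have hub₃ : (openGraph ω₃).Reachable u b ↔ (openGraph ω₃').Reachable u b := by
    rcases hb with hbO | huZ
    · exact out₃ hu hbO
    · by_cases hbO : b ∈ O
      · have hZc : ∀ z ∈ Z, z = c := fun z hz => (hZ z hz).resolve_left (by rintro rfl; exact huZ hz)
        have h3 := not_reachable_ub hF hO₃ hZc hbO hu huc₃
        have h3' := not_reachable_ub hF hO₃' hZc hbO hu (fun h' => huc₃ ((out₃ hu hc).2 h'))
        exact ⟨fun h' => absurd h' h3, fun h' => absurd h' h3'⟩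
      · exact out₃ hu hbO
  -- Step 6: rewrite everything and conclude with the arithmetic of the swap
  simp only [hNu, hNv, hNu', hNv', hD₂, hD₃, hD₃', hvo₃, hvo₃', hvc₃, hvc₃', hoc₁, hoc₁', hE₁', hE₃',
    not_false_eq_true, true_and, and_true] at hne ⊢
  rw [← hub₃]
  exact swap_arith _ _ _ _


/-- **ψ_o: the fibre counts of (T) reduce to the triples not cut off by `{u, c}`.**  For `o, u, c` pairwise distinct and
every count vector `I`, `fibreSumT o b u v c I` equals the sum of its signed summand over the replica triples
`t = (ω¹, ω², ω³)` of the fibre `{cnt = I}` which VIOLATE: "`v ∉ R` and (`b ∉ R` or no `(ω¹ ∪ ω³)`-open edge joins `R` to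
`u`)", where `R = R(t)` is the set of vertices joined to `o` by `(ω¹ ∪ ω³)`-open edges avoiding `u` and `c` (any finset `S`
with this membership, hypothesis `hS`); all other triples cancel in pairs under the swap `1 ↔ 3` on the edges touching `R`.
[folklore] -/
theorem fibreSumT_eq_sum_cutoff (o b u v c : Fin n) (hou : o ≠ u) (hoc : o ≠ c) (huc : u ≠ c) (I : Sym2 (Fin n) → ℕ)
    (S : Finset (Triple (Sym2 (Fin n))))
    (hS : ∀ t, t ∈ S ↔ cnt t = I ∧
      ¬ (¬ (openGraph ((cfg t.1 ∪ cfg t.2.2) \ {e | u ∈ e ∨ c ∈ e})).Reachable o v ∧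
          (¬ (openGraph ((cfg t.1 ∪ cfg t.2.2) \ {e | u ∈ e ∨ c ∈ e})).Reachable o b ∨
            ∀ e ∈ cfg t.1 ∪ cfg t.2.2, u ∈ e → ∀ y ∈ e,
              ¬ (openGraph ((cfg t.1 ∪ cfg t.2.2) \ {e | u ∈ e ∨ c ∈ e})).Reachable o y))) :
    fibreSumT o b u v c I =
      ∑ t ∈ S,
        (1 * ind ((openConn c u)ᶜ ∩ (openConn c v)ᶜ) ((openConn u v)ᶜ ∩ openConn u b) ((openConn u v)ᶜ ∩ openConn v o) t +
          (-1) * ind ((openConn c u)ᶜ ∩ (openConn c v)ᶜ) (openConn u v)ᶜ ((openConn u v)ᶜ ∩ openConn u b ∩ openConn v o) t +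
          (-1) * ind ((openConn c u)ᶜ ∩ (openConn c v)ᶜ ∩ openConn o c) ((openConn u v)ᶜ ∩ openConn u b)
            ((openConn u v)ᶜ ∩ openConn v c) t +
          1 * ind ((openConn c u)ᶜ ∩ (openConn c v)ᶜ ∩ openConn o c) (openConn u v)ᶜ
            ((openConn u v)ᶜ ∩ openConn u b ∩ openConn v c) t) := by
  unfold fibreSumT
  -- the region `O t`, the edges `F t` touching it, and the swap `Φ`, kept opaque
  obtain ⟨O, hOdef⟩ : ∃ O : Triple (Sym2 (Fin n)) → Set (Fin n),
      ∀ t x, x ∈ O t ↔ (openGraph ((cfg t.1 ∪ cfg t.2.2) \ {e | u ∈ e ∨ c ∈ e})).Reachable o x :=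
    ⟨fun t => {x | (openGraph ((cfg t.1 ∪ cfg t.2.2) \ {e | u ∈ e ∨ c ∈ e})).Reachable o x}, fun _ _ => Iff.rfl⟩
  obtain ⟨F, hF⟩ : ∃ F : Triple (Sym2 (Fin n)) → Set (Sym2 (Fin n)), ∀ t e, e ∈ F t ↔ ∃ x ∈ e, x ∈ O t :=
    ⟨fun t => {e | ∃ x ∈ e, x ∈ O t}, fun _ _ => Iff.rfl⟩
  obtain ⟨Φ, hΦ₁, hΦ₂, hΦ₃⟩ : ∃ Φ : Triple (Sym2 (Fin n)) → Triple (Sym2 (Fin n)),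
      (∀ t, (Φ t).1 = fun i => if i ∈ F t then t.2.2 i else t.1 i) ∧ (∀ t, (Φ t).2.1 = t.2.1) ∧
      (∀ t, (Φ t).2.2 = fun i => if i ∈ F t then t.1 i else t.2.2 i) :=
    ⟨fun t => (fun i => if i ∈ F t then t.2.2 i else t.1 i, t.2.1, fun i => if i ∈ F t then t.1 i else t.2.2 i),
      fun _ => rfl, fun _ => rfl, fun _ => rfl⟩
  -- the union `ω¹ ∪ ω³`, hence the region and the swapped edge set, are invariant
  have hU : ∀ t, cfg (Φ t).1 ∪ cfg (Φ t).2.2 = cfg t.1 ∪ cfg t.2.2 := fun t => by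
    rw [hΦ₁, hΦ₃]; exact cfg_union_swap (F t) t.1 t.2.2
  have hOΦ : ∀ t, O (Φ t) = O t := fun t => by
    ext x; rw [hOdef, hOdef, hU]
  have hFΦ : ∀ t, F (Φ t) = F t := fun t => by
    ext e; rw [hF, hF, hOΦ]
  have hinv : ∀ t, Φ (Φ t) = t := by
    intro t
    ext i
    · rw [hΦ₁, hFΦ, hΦ₁, hΦ₃]; simp only; split_ifs <;> rfl
    · rw [hΦ₂, hΦ₂]
    · rw [hΦ₃, hFΦ, hΦ₁, hΦ₃]; simp only; split_ifs <;> rfl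
  have hcnt : ∀ t, cnt (Φ t) = cnt t := by
    intro t; funext i
    simp only [cnt, cnt3, hΦ₁, hΦ₂, hΦ₃]
    split_ifs
    · omega
    · rfl
  have hP : ∀ t, (¬ (openGraph ((cfg t.1 ∪ cfg t.2.2) \ {e | u ∈ e ∨ c ∈ e})).Reachable o v ∧
          (¬ (openGraph ((cfg t.1 ∪ cfg t.2.2) \ {e | u ∈ e ∨ c ∈ e})).Reachable o b ∨
            ∀ e ∈ cfg t.1 ∪ cfg t.2.2, u ∈ e → ∀ y ∈ e,
              ¬ (openGraph ((cfg t.1 ∪ cfg t.2.2) \ {e | u ∈ e ∨ c ∈ e})).Reachable o y)) →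
      (¬ (openGraph ((cfg (Φ t).1 ∪ cfg (Φ t).2.2) \ {e | u ∈ e ∨ c ∈ e})).Reachable o v ∧
          (¬ (openGraph ((cfg (Φ t).1 ∪ cfg (Φ t).2.2) \ {e | u ∈ e ∨ c ∈ e})).Reachable o b ∨
            ∀ e ∈ cfg (Φ t).1 ∪ cfg (Φ t).2.2, u ∈ e → ∀ y ∈ e,
              ¬ (openGraph ((cfg (Φ t).1 ∪ cfg (Φ t).2.2) \ {e | u ∈ e ∨ c ∈ e})).Reachable o y)) := fun t ht => by
    rw [hU]; exact ht
  refine fibreSum4_eq_sum_of_involution Φ _ I S hS hinv hcnt hP 1 (-1) (-1) 1 _ _ _ _ _ _ _ _ _ _ _ _ ?_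
  intro t ht hPt hne
  -- the separator set `Z`: always `c`; `u` only if some `(ω¹ ∪ ω³)`-edge joins the region to `u`
  obtain ⟨Z, hZdef⟩ : ∃ Z : Set (Fin n), ∀ z, z ∈ Z ↔ z = c ∨ (z = u ∧ ∃ e ∈ cfg t.1 ∪ cfg t.2.2, u ∈ e ∧ ∃ y ∈ e,
      (openGraph ((cfg t.1 ∪ cfg t.2.2) \ {e | u ∈ e ∨ c ∈ e})).Reachable o y) :=
    ⟨{z | z = c ∨ (z = u ∧ ∃ e ∈ cfg t.1 ∪ cfg t.2.2, u ∈ e ∧ ∃ y ∈ e,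
      (openGraph ((cfg t.1 ∪ cfg t.2.2) \ {e | u ∈ e ∨ c ∈ e})).Reachable o y)}, fun _ => Iff.rfl⟩
  have ho : o ∈ O t := (hOdef t o).2 (SimpleGraph.Reachable.refl o)
  have hu : u ∉ O t := fun h' => hou (eq_of_reachable_avoid₂ ((hOdef t u).1 h'))
  have hc : c ∉ O t := by
    intro h'
    have h'' := (hOdef t c).1 h'
    have hset : {e : Sym2 (Fin n) | u ∈ e ∨ c ∈ e} = {e | c ∈ e ∨ u ∈ e} := by
      ext e; simp only [Set.mem_setOf_eq]; exact or_comm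
    rw [hset] at h''
    exact hoc (eq_of_reachable_avoid₂ h'')
  have hv : v ∉ O t := fun h' => hPt.1 ((hOdef t v).1 h')
  have hZ : ∀ z ∈ Z, z = u ∨ z = c := fun z hz => by
    rcases (hZdef z).1 hz with h' | h'
    · exact Or.inr h'
    · exact Or.inl h'.1
  have hb : b ∉ O t ∨ u ∉ Z := by
    rcases hPt.2 with h' | h'
    · exact Or.inl fun h'' => h' ((hOdef t b).1 h'')
    · refine Or.inr fun huZ => ?_
      rcases (hZdef u).1 huZ with h'' | ⟨_, e, he, hue, y, hy, hoy⟩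
      · exact huc h''
      · exact h' e he hue y hy hoy
  have hO : ∀ e ∈ cfg t.1 ∪ cfg t.2.2, ∀ x ∈ e, x ∈ O t → ∀ y ∈ e, y ∈ O t ∨ y ∈ Z := by
    intro e he x hx hxO y hy
    have := closed_of_subset_reach₂ (η := cfg t.1 ∪ cfg t.2.2) hou hoc subset_rfl hZdef e he x hx
      ((hOdef t x).1 hxO) y hy
    rcases this with h' | h'
    · exact Or.inl ((hOdef t y).2 h')
    · exact Or.inr h'
  exact summandT_swap13_neg o b u v c (F t) (O t) Z (hF t) ho hu hv hc hZ hb t hO Φ (hΦ₁ t) (hΦ₂ t) (hΦ₃ t) hne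

end SwapO

end Summit.CriticalPhenomena.PercolationContinuityZ3.Cruxes.AdditiveGluing.TieLine.FibreCount
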